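import Literature.Probability.Percolation.MarkedLoopTwoCellProfile
import HarnessLib

/-!
# The two-cell cap identity of the boundary link-pattern law («LAW-TWO-CELL-CAP»)

Topic `Literature/Probability/Percolation`; generic-`k` layer of the marked-loop (Khristoforov–Smirnov) lineage; the Bollobás–Riordan-representable replacement of the one-hexagon cap
surgery F1 (HOME `FINDING-TWO-CELL-CAP-IDENTITY.md` §2), on `MarkedLoopTwoCellRing.lean` («TWO-CELL-RING»: `TwoCellData`, the parity walk) and `MarkedLoopTwoCellProfile.lean`
(«TWO-CELL-PROFILE»: `TwoCellProfile`, `PendantCase` / `CapCase` and their bijections `card_filter_case_eq`, `inClassX_union_iff₀` / `linkRel_union_eq₀`), assembled by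
`MarkedLoopPatternCapIns.lean` (`lawLP_eq_capInsL_add₃`).

THE IDENTITY. For `D = (Ω; M̂)` (`k` corners, sites `G`) and `W = (Ω ∪ h₁ ∪ h₂; M̂ + a + b)` (two adjacent hexagons attached, the new corners `a`, `b` on their outer paths at the adjacent
indices `{ja, jb} = {j, j+1}` — `TwoCellData`), and the three small domains `E_PQ = (Ω; M̂ + P + Q)`, `E_Pc = (Ω; M̂ + P + c)`, `E_cQ = (Ω; M̂ + c + Q)` marked additionally at two of the
three contact faces `P` (first contact end), `c` (inner junction), `Q` (last contact end) at the indices `ja, jb` (`TwoCellMarks`), at every mid-edge `z` of the common home arc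
  `lawLP z_W = capInsL j (lawLP z_D) + lawLP z_PQ + lawLP z_Pc + lawLP z_cQ`
(`TwoCellData.lawLP_eq_capInsL_add₃`), i.e. `law(Ω∪h₁∪h₂; M̂+a+b) = cap_{a,b}·law(Ω; M̂) + law(Ω; M̂+P+Q) + law(Ω; M̂+P+c) + law(Ω; M̂+c+Q)`. Mechanism (Khristoforov–Smirnov §1.2: a
configuration with prescribed disorders is a union of disjoint paths matching the marked points; Pearce–Rittenberg–de Gier–Nienhuis §2: the cap half of `e_j`): by the parity walk
the new-bond part of a configuration of `W` is one of four profiles, indexed by `x = [nb¹_0 ∈ ζ]`, `y = [I ∈ ζ]`; deleting it gives a configuration of `D` (cap case `x = y = ⊥`: the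
profile is a rootless path `a ~ b`, the pattern is the cap insertion of the small pattern), of `E_PQ` (`x, ¬y`: two pendants `a ~ P`, `b ~ Q`), of `E_Pc` (`x, y`: `a ~ P`, `b ~ c`
through the interior bond) or of `E_cQ` (`¬x, y`: `a ~ c`, `b ~ Q`), with the same pattern.

* §1 the four profiles as explicit bond sets: `pqSet`, `pcSet`, `cqSet`, `capSet` (unions of the half paths `EN` / `SlideData.EQ` of #848/#937 and the interior bond), their
  profiles `TwoCellData.twoCellProfile_pq/pc/cq/cap`, and ★ the case data `TwoCellData.pendantCase_pq/pc/cq` (from `TwoCellMarks`), `TwoCellData.capCase`;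
* §2 ★★★ `TwoCellData.card_filter_cap_eq_sum` (the cap-case class count is the sum over the cap-insertion fibre), ★★★ `TwoCellData.patternCount_eq` — **THE COUNT IDENTITY**
  `N^{W}_q = Σ_{p : p.capIns j = q} N^{D}_p + N^{PQ}_q + N^{Pc}_q + N^{cQ}_q`, ★★★★ `TwoCellData.lawLP_eq_capInsL_add₃` — **THE TWO-CELL CAP IDENTITY** in the planar Temperley–Lieb
  module.

What it is for: with the SLIDE identity (#848, constructed in `MarkedLoopLawSlideOfDarts`), F2 (#937, constructed in #945) and the cap criterion `bSpan_of_tighten_capIns'` (#887) this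
is the last surgery identity of the lane's BSPAN-by-towers programme in Bollobás–Riordan coordinates: `capInsL j (lawLP z_D)` is a signed sum of four BR lawpoints. The constructor
(existence of `W`, `E_PQ`, `E_Pc`, `E_cQ` as `TriMarkedDomain`s from a two-cell dart datum) is typed separately.

## References
* M. Khristoforov, S. Smirnov, *Percolation and O(1) loop model*, arXiv:2111.15612v1 (2021), §1.2 (p. 2: loop configurations with boundary disorders, «IP(ξ) is a union of
  disjoint paths, matching marked points», the law of the link pattern), §2 Definition 3 (p. 4), eq. (4) (p. 5).
* P. A. Pearce, V. Rittenberg, J. de Gier, B. Nienhuis, *Temperley–Lieb stochastic processes*, J. Phys. A 35 (2002) L661–L668, §2 ((monoid): `e_j` = cap ∘ contraction; the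
  link-pattern module).
* B. Bollobás, O. Riordan, *Percolation*, Cambridge University Press 2006, Ch. 7 §7.2.2 pp. 168–169 (discrete domains; attaching hexagons along the boundary; marked sites).

## Mathlib / tree
Tree: `MarkedLoopTwoCellRing`, `MarkedLoopTwoCellProfile` (all of it), `MarkedLoopLawContract` (`EN`, `mem_EN_iff`, `nbond_mem_EN_iff`, `EN_reachable`, `EN_faces`,
`exists_pat₀_of_mem_TXb`, `pat₀_unique_of_mem_TXb`), `MarkedLoopLawSlide` (`SlideData.EQ`, `SlideData.mem_EQ_iff`, `SlideData.nbond_mem_EQ_iff`, `SlideData.adj_N_succ`, `nbond_inj`,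
`eq_N_or_of_inc`, `N_inj`), `MarkedLoopPatternCapIns` (`Pat₀.capIns`, `lawLP_eq_capInsL_add₃`), `MarkedLoopLawAttachSplit` / `MarkedLoopTripodBasis` (`patternCount`),
`MarkedLoopBoundarySpan` (`ArcPoint`), `KhSThreeDisorderObservable` (`TXb`, `mem_TXb_iff`, `InClassX`). Mathlib: `Finset.card_bij`, `Finset.card_biUnion`,
`Finset.card_filter_add_card_filter_not`, `Finset.filter_filter`, `Finset.filter_congr`.
-/

open Finset

namespace Literature.Probability.Percolation.MarkedLoops

open Literature.Probability.Percolation Literature.Probability.LatticeModels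
open Literature.Probability.LatticeModels.TemperleyLieb
open Literature.Probability.Percolation.FivePoint (side side_injective XiLinked Inc inc_side inc_mk_iff xiDeg)
open Literature.Probability.Percolation.FivePoint.N5 (sideGraph side_oppFace_oppIdx xiLinked_iff_reachable l1_xiDeg_eq ht2_sideGraph_mono)
open TriMarkedDomain

/-! ## §1 The four profiles as explicit bond sets, and their case data -/

section Cases

variable {nm : ℕ}

/-- **the `(P, Q)` profile** (bits `⊤, ⊥`): the half path `P — ⋯ — a` of `h₁` and the half path `b — ⋯ — Q` of `h₂`. [cite: KhristoforovSmirnov2021, §1.2 (arXiv v1 p. 2); lane tool notion] -/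
def pqSet (h₁ h₂ : Site 2) (r₁ k₁ r₂ m₂ k₂ : Fin 6) : Finset (Sym2 (Site 2)) := EN h₁ r₁ k₁ ∪ SlideData.EQ h₂ r₂ m₂ k₂

/-- **the `(P, c)` profile** (bits `⊤, ⊤`): the half path `P — ⋯ — a` of `h₁`, and the interior bond followed by the half path `c — J — ⋯ — b` of `h₂`.
[cite: KhristoforovSmirnov2021, §1.2 (arXiv v1 p. 2); lane tool notion] -/
def pcSet (h₁ h₂ : Site 2) (r₁ m₁ k₁ r₂ k₂ : Fin 6) : Finset (Sym2 (Site 2)) := EN h₁ r₁ k₁ ∪ insert (nbond h₁ (r₁ + (m₁ + 1))) (EN h₂ r₂ k₂)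

/-- **the `(c, Q)` profile** (bits `⊥, ⊤`): the half path `a — ⋯ — J — c` of `h₁` through the interior bond, and the half path `b — ⋯ — Q` of `h₂`.
[cite: KhristoforovSmirnov2021, §1.2 (arXiv v1 p. 2); lane tool notion] -/
def cqSet (h₁ h₂ : Site 2) (r₁ m₁ k₁ r₂ m₂ k₂ : Fin 6) : Finset (Sym2 (Site 2)) := insert (nbond h₁ (r₁ + (m₁ + 1))) (SlideData.EQ h₁ r₁ m₁ k₁) ∪ SlideData.EQ h₂ r₂ m₂ k₂

/-- **the cap profile** (bits `⊥, ⊥`): the path `a — ⋯ — J — ⋯ — b` along the outer boundary of the two cells. [cite: KhristoforovSmirnov2021, §1.2 (arXiv v1 p. 2); PearceRittenbergDeGierNienhuis2002, §2 (the cap); lane tool notion] -/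
def capSet (h₁ h₂ : Site 2) (r₁ m₁ k₁ r₂ k₂ : Fin 6) : Finset (Sym2 (Site 2)) := SlideData.EQ h₁ r₁ m₁ k₁ ∪ EN h₂ r₂ k₂

namespace TwoCellData

variable {W : TriMarkedDomain (nm + 1 + 1)} {D : TriMarkedDomain nm} {h₁ h₂ : Site 2} {r₁ m₁ k₁ r₂ m₂ k₂ : Fin 6} {ja jb : Fin (nm + 1 + 1)} {j : Fin (nm + 1)}
  (T : TwoCellData W D h₁ h₂ r₁ m₁ k₁ r₂ m₂ k₂ ja jb j)
include T

/-! ### Bonds of `h₁` against bonds of `h₂` -/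

/-- ★ **the bonds at `h₁` and at `h₂` share exactly the interior bond**: `nbond h₁ s = nbond h₂ t ↔ s = r₁ + m₁ + 1 ∧ t = r₂ + 5`. [cite: BollobasRiordan2006, Ch. 7 §7.2.2 p. 168] -/
theorem nbond₁_eq_nbond₂_iff (s t : Fin 6) : nbond h₁ s = nbond h₂ t ↔ s = r₁ + (m₁ + 1) ∧ t = r₂ + 5 := by
  rw [T.h₂_eq, nbond_eq_nbond_add_triDir_iff, T.r₂_eq]
  have e : r₁ + (m₁ + 1) + 3 = r₁ + (m₁ + 5) + 5 := by omega
  rw [e]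

/-- a bond `nb¹_k`, `k ≤ m₁`, is not an `nbond` of `h₂`. [cite: BollobasRiordan2006, Ch. 7 §7.2.2 p. 168] -/
theorem nbond₁_ne_nbond₂ {k : Fin 6} (hk : k ≤ m₁) (t : Fin 6) : nbond h₁ (r₁ + k) ≠ nbond h₂ t := by
  rw [Ne, T.nbond₁_eq_nbond₂_iff]
  have hm := T.m₁_le
  rintro ⟨e, -⟩
  have : k = m₁ + 1 := add_left_cancel e
  omega

/-- a bond `nb²_k`, `k ≠ 5`, is not an `nbond` of `h₁`. [cite: BollobasRiordan2006, Ch. 7 §7.2.2 p. 168] -/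
theorem nbond₂_ne_nbond₁ {k : Fin 6} (hk : k ≠ 5) (s : Fin 6) : nbond h₂ (r₂ + k) ≠ nbond h₁ s := by
  intro e
  have := (T.nbond₁_eq_nbond₂_iff s (r₂ + k)).1 e.symm
  exact hk (add_left_cancel this.2)

/-- `nb¹_l ∉ EN h₂ r₂ m` for `l ≤ m₁` and `m ≤ 3`. [cite: KhristoforovSmirnov2021, §1.2 (arXiv v1 p. 2)] -/
theorem nbond₁_not_mem_EN₂ {l m : Fin 6} (hl : l ≤ m₁) : nbond h₁ (r₁ + l) ∉ EN h₂ r₂ m := by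
  intro h
  obtain ⟨k, -, e⟩ := mem_EN_iff.1 h
  exact T.nbond₁_ne_nbond₂ hl _ e

/-- `nb¹_l ∉ EQ h₂ r₂ m₂ k₂` for `l ≤ m₁`. [cite: KhristoforovSmirnov2021, §1.2 (arXiv v1 p. 2)] -/
theorem nbond₁_not_mem_EQ₂ {l : Fin 6} (hl : l ≤ m₁) : nbond h₁ (r₁ + l) ∉ SlideData.EQ h₂ r₂ m₂ k₂ := by
  intro h
  obtain ⟨k, -, e⟩ := SlideData.mem_EQ_iff.1 h
  exact T.nbond₁_ne_nbond₂ hl _ e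

/-- the interior bond is not in `EN h₂ r₂ m` for `m ≤ 3`. [cite: KhristoforovSmirnov2021, §1.2 (arXiv v1 p. 2)] -/
theorem I_not_mem_EN₂ {m : Fin 6} (hm : m.val ≤ 3) : nbond h₁ (r₁ + (m₁ + 1)) ∉ EN h₂ r₂ m := by
  intro h
  obtain ⟨k, hk, e⟩ := mem_EN_iff.1 h
  have := ((T.nbond₁_eq_nbond₂_iff _ _).1 e).2
  have h5 : k = 5 := add_left_cancel this
  subst h5
  exact absurd hk (by omega)

/-- the interior bond is not in `EQ h₂ r₂ m₂ k₂`. [cite: KhristoforovSmirnov2021, §1.2 (arXiv v1 p. 2)] -/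
theorem I_not_mem_EQ₂ : nbond h₁ (r₁ + (m₁ + 1)) ∉ SlideData.EQ h₂ r₂ m₂ k₂ := by
  intro h
  obtain ⟨k, hk, e⟩ := SlideData.mem_EQ_iff.1 h
  have := ((T.nbond₁_eq_nbond₂_iff _ _).1 e).2
  have h5 : k = 5 := add_left_cancel this
  have hm := T.m₂_le
  subst h5
  exact absurd hk.2 (by omega)

/-- `nb²_l ∉ EN h₁ r₁ k₁` for `l ≤ m₂`. [cite: KhristoforovSmirnov2021, §1.2 (arXiv v1 p. 2)] -/
theorem nbond₂_not_mem_EN₁ {l : Fin 6} (hl : l ≤ m₂) : nbond h₂ (r₂ + l) ∉ EN h₁ r₁ k₁ := by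
  intro h
  obtain ⟨k, -, e⟩ := mem_EN_iff.1 h
  have hm := T.m₂_le
  exact T.nbond₂_ne_nbond₁ (k := l) (by omega) _ e

/-- `nb²_l ∉ EQ h₁ r₁ m₁ k₁` for `l ≤ m₂`. [cite: KhristoforovSmirnov2021, §1.2 (arXiv v1 p. 2)] -/
theorem nbond₂_not_mem_EQ₁ {l : Fin 6} (hl : l ≤ m₂) : nbond h₂ (r₂ + l) ∉ SlideData.EQ h₁ r₁ m₁ k₁ := by
  intro h
  obtain ⟨k, -, e⟩ := SlideData.mem_EQ_iff.1 h
  have hm := T.m₂_le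
  exact T.nbond₂_ne_nbond₁ (k := l) (by omega) _ e

/-- `nb²_l ≠ I` for `l ≤ m₂`. [cite: KhristoforovSmirnov2021, §1.2 (arXiv v1 p. 2)] -/
theorem nbond₂_ne_I {l : Fin 6} (hl : l ≤ m₂) : nbond h₂ (r₂ + l) ≠ nbond h₁ (r₁ + (m₁ + 1)) := by
  have hm := T.m₂_le
  exact T.nbond₂_ne_nbond₁ (by omega) _

/-- `nb¹_l ≠ I` for `l ≤ m₁`. [cite: KhristoforovSmirnov2021, §1.2 (arXiv v1 p. 2)] -/
theorem nbond₁_ne_I {l : Fin 6} (hl : l ≤ m₁) : nbond h₁ (r₁ + l) ≠ nbond h₁ (r₁ + (m₁ + 1)) := by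
  intro e
  have hm := T.m₁_le
  have := add_left_cancel (nbond_inj e)
  omega

/-! ### The four bond sets are the four profiles -/

/-- ★ **the `(P, Q)` set is the profile with bits `⊤, ⊥`.** [cite: KhristoforovSmirnov2021, §1.2 (arXiv v1 pp. 2–3)] -/
theorem twoCellProfile_pq : TwoCellProfile h₁ h₂ r₁ m₁ k₁ r₂ m₂ k₂ (pqSet h₁ h₂ r₁ k₁ r₂ m₂ k₂) True False := by
  have hm₁ := T.m₁_le
  have h0₁ := T.k₁_lt
  unfold pqSet
  refine ⟨fun b hb => ?_, fun k hk => ?_, ?_, fun k hk => ?_⟩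
  · rcases Finset.mem_union.1 hb with hb | hb
    · obtain ⟨k, hk, rfl⟩ := mem_EN_iff.1 hb
      exact Or.inl ⟨k, by omega, rfl⟩
    · obtain ⟨k, hk, rfl⟩ := SlideData.mem_EQ_iff.1 hb
      exact Or.inr ⟨k, hk.2, rfl⟩
  · rw [Finset.mem_union, nbond_mem_EN_iff]
    exact ⟨fun h => ⟨fun _ => h.resolve_right (T.nbond₁_not_mem_EQ₂ hk), fun _ => trivial⟩, fun h => Or.inl (h.1 trivial)⟩
  · rw [Finset.mem_union, nbond_mem_EN_iff]
    refine iff_of_false ?_ id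
    rintro (h | h)
    · exact absurd h (by omega)
    · exact T.I_not_mem_EQ₂ h
  · rw [Finset.mem_union, SlideData.nbond_mem_EQ_iff]
    constructor
    · rintro (h | h)
      · exact absurd h (T.nbond₂_not_mem_EN₁ hk)
      · exact ⟨fun h' => (h'.1 trivial).elim, fun h' => absurd h' (by omega)⟩
    · intro h
      exact Or.inr ⟨by by_contra h'; exact (h.2 (by omega)).1 trivial, hk⟩

/-- ★ **the `(P, c)` set is the profile with bits `⊤, ⊤`.** [cite: KhristoforovSmirnov2021, §1.2 (arXiv v1 pp. 2–3)] -/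
theorem twoCellProfile_pc : TwoCellProfile h₁ h₂ r₁ m₁ k₁ r₂ m₂ k₂ (pcSet h₁ h₂ r₁ m₁ k₁ r₂ k₂) True True := by
  have hm₁ := T.m₁_le
  have hm₂ := T.m₂_le
  have h0₁ := T.k₁_lt
  have h0₂ := T.k₂_lt
  unfold pcSet
  refine ⟨fun b hb => ?_, fun k hk => ?_, ?_, fun k hk => ?_⟩
  · rcases Finset.mem_union.1 hb with hb | hb
    · obtain ⟨k, hk, rfl⟩ := mem_EN_iff.1 hb
      exact Or.inl ⟨k, by omega, rfl⟩
    · rcases Finset.mem_insert.1 hb with rfl | hb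
      · exact Or.inl ⟨m₁ + 1, le_rfl, rfl⟩
      · obtain ⟨k, hk, rfl⟩ := mem_EN_iff.1 hb
        exact Or.inr ⟨k, by omega, rfl⟩
  · rw [Finset.mem_union, nbond_mem_EN_iff, Finset.mem_insert]
    constructor
    · rintro (h | e | h)
      · exact ⟨fun _ => h, fun _ => trivial⟩
      · exact absurd e (T.nbond₁_ne_I hk)
      · exact absurd h (T.nbond₁_not_mem_EN₂ hk)
    · exact fun h => Or.inl (h.1 trivial)
  · exact iff_of_true (Finset.mem_union_right _ (Finset.mem_insert_self _ _)) trivial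
  · rw [Finset.mem_union, Finset.mem_insert, nbond_mem_EN_iff]
    constructor
    · rintro (h | h | h)
      · exact absurd h (T.nbond₂_not_mem_EN₁ hk)
      · exact absurd h (T.nbond₂_ne_I hk)
      · exact ⟨fun _ => h, fun _ => Iff.rfl⟩
    · exact fun h => Or.inr (Or.inr (h.1 Iff.rfl))

/-- ★ **the `(c, Q)` set is the profile with bits `⊥, ⊤`.** [cite: KhristoforovSmirnov2021, §1.2 (arXiv v1 pp. 2–3)] -/
theorem twoCellProfile_cq : TwoCellProfile h₁ h₂ r₁ m₁ k₁ r₂ m₂ k₂ (cqSet h₁ h₂ r₁ m₁ k₁ r₂ m₂ k₂) False True := by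
  have hm₁ := T.m₁_le
  have hm₂ := T.m₂_le
  have h0₁ := T.k₁_lt
  have h0₂ := T.k₂_lt
  unfold cqSet
  refine ⟨fun b hb => ?_, fun k hk => ?_, ?_, fun k hk => ?_⟩
  · rcases Finset.mem_union.1 hb with hb | hb
    · rcases Finset.mem_insert.1 hb with rfl | hb
      · exact Or.inl ⟨m₁ + 1, le_rfl, rfl⟩
      · obtain ⟨k, hk, rfl⟩ := SlideData.mem_EQ_iff.1 hb
        exact Or.inl ⟨k, by omega, rfl⟩
    · obtain ⟨k, hk, rfl⟩ := SlideData.mem_EQ_iff.1 hb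
      exact Or.inr ⟨k, hk.2, rfl⟩
  · rw [Finset.mem_union, Finset.mem_insert, SlideData.nbond_mem_EQ_iff]
    constructor
    · rintro ((h | h) | h)
      · exact absurd h (T.nbond₁_ne_I hk)
      · exact ⟨fun h' => h'.elim, fun h' => absurd h' (by omega)⟩
      · exact absurd h (T.nbond₁_not_mem_EQ₂ hk)
    · intro h
      exact Or.inl (Or.inr ⟨by by_contra h'; exact h.2 (by omega), hk⟩)
  · exact iff_of_true (Finset.mem_union_left _ (Finset.mem_insert_self _ _)) trivial
  · rw [Finset.mem_union, Finset.mem_insert, SlideData.nbond_mem_EQ_iff]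
    constructor
    · rintro ((h | h) | h)
      · exact absurd h (T.nbond₂_ne_I hk)
      · exact absurd h (T.nbond₂_not_mem_EQ₁ hk)
      · exact ⟨fun h' => (h'.2 trivial).elim, fun h' => absurd h' (by omega)⟩
    · intro h
      exact Or.inr ⟨by by_contra h'; exact (h.2 (by omega)).2 trivial, hk⟩

/-- ★ **the cap set is the profile with bits `⊥, ⊥`.** [cite: KhristoforovSmirnov2021, §1.2 (arXiv v1 pp. 2–3); PearceRittenbergDeGierNienhuis2002, §2 (the cap)] -/
theorem twoCellProfile_cap : TwoCellProfile h₁ h₂ r₁ m₁ k₁ r₂ m₂ k₂ (capSet h₁ h₂ r₁ m₁ k₁ r₂ k₂) False False := by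
  have hm₁ := T.m₁_le
  have hm₂ := T.m₂_le
  have h0₁ := T.k₁_lt
  have h0₂ := T.k₂_lt
  unfold capSet
  refine ⟨fun b hb => ?_, fun k hk => ?_, ?_, fun k hk => ?_⟩
  · rcases Finset.mem_union.1 hb with hb | hb
    · obtain ⟨k, hk, rfl⟩ := SlideData.mem_EQ_iff.1 hb
      exact Or.inl ⟨k, by omega, rfl⟩
    · obtain ⟨k, hk, rfl⟩ := mem_EN_iff.1 hb
      exact Or.inr ⟨k, by omega, rfl⟩
  · rw [Finset.mem_union, SlideData.nbond_mem_EQ_iff]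
    constructor
    · rintro (h | h)
      · exact ⟨fun h' => h'.elim, fun h' => absurd h' (by omega)⟩
      · exact absurd h (T.nbond₁_not_mem_EN₂ hk)
    · intro h
      exact Or.inl ⟨by by_contra h'; exact h.2 (by omega), hk⟩
  · rw [Finset.mem_union, SlideData.nbond_mem_EQ_iff]
    refine iff_of_false ?_ id
    rintro (h | h)
    · exact absurd h.2 (by omega)
    · exact T.I_not_mem_EN₂ (by omega) h
  · rw [Finset.mem_union, nbond_mem_EN_iff]
    constructor
    · rintro (h | h)
      · exact absurd h (T.nbond₂_not_mem_EQ₁ hk)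
      · exact ⟨fun _ => h, fun _ => Iff.rfl⟩
    · exact fun h => Or.inr (h.1 Iff.rfl)

/-! ### The three pendant cases and the cap case -/

omit T in
/-- `J — c` across the interior bond: adjacency in any set containing `I`. [cite: KhristoforovSmirnov2021, §1.2 (arXiv v1 p. 2)] -/
theorem adj_J_c {E : Finset (Sym2 (Site 2))} (hI : nbond h₁ (r₁ + (m₁ + 1)) ∈ E) :
    (sideGraph E).Adj (leftFaceDir h₁ (r₁ + m₁)) (leftFaceDir h₁ (r₁ + (m₁ + 1))) := by
  have h1 := SlideData.adj_N_succ (E := E) (r₁ + m₁) (by rw [add_assoc r₁ m₁ 1]; exact hI)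
  rwa [add_assoc r₁ m₁ 1] at h1

/-- ★ **THE `(P, Q)` PENDANT CASE** from the marks data `(Ω; M̂ + P + Q)`: `E₁ = P — ⋯ — a` rooted at `P`, `E₂ = b — ⋯ — Q` rooted at `Q`.
[cite: KhristoforovSmirnov2021, §1.2 (arXiv v1 p. 2: «IP(ξ) is a union of disjoint paths»); BollobasRiordan2006, Ch. 7 §7.2.2 pp. 168–169] -/
theorem pendantCase_pq {E : TriMarkedDomain (nm + 1 + 1)} (M : TwoCellMarks D E ja jb j (leftFaceDir h₁ (r₁ + 5)) (leftFaceDir h₂ (r₂ + m₂))) :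
    PendantCase D h₁ h₂ r₁ m₁ k₁ r₂ m₂ k₂ ja jb j E True False (pqSet h₁ h₂ r₁ k₁ r₂ m₂ k₂) (EN h₁ r₁ k₁) (SlideData.EQ h₂ r₂ m₂ k₂)
      (((Finset.univ : Finset (Fin 6)).filter fun k => k ≤ k₁).image fun k => leftFaceDir h₁ (r₁ + k))
      (((Finset.univ : Finset (Fin 6)).filter fun k => k₂ ≤ k ∧ k < m₂).image fun k => leftFaceDir h₂ (r₂ + k))
      (leftFaceDir h₁ (r₁ + 5)) (leftFaceDir h₂ (r₂ + m₂)) := by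
  have hm₁ := T.m₁_le
  have hm₂ := T.m₂_le
  have h0₁ := T.k₁_lt
  have h0₂ := T.k₂_lt
  refine
    { marks := M
      R₁_touching := T.P_touching
      R₂_touching := T.Q_touching
      root_iff := fun F _ => ?_
      profile := T.twoCellProfile_pq
      N_eq := rfl
      S_outer := fun F hF => ?_
      faces₁ := fun b hb F hF => ?_
      faces₂ := fun b hb F hF => ?_
      disjS := ?_
      disj₁₂ := ?_
      a_mem := Finset.mem_image.2 ⟨k₁, Finset.mem_filter.2 ⟨Finset.mem_univ _, le_rfl⟩, rfl⟩
      b_mem := Finset.mem_image.2 ⟨k₂, Finset.mem_filter.2 ⟨Finset.mem_univ _, le_rfl, h0₂⟩, rfl⟩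
      conn₁ := (EN_reachable (by omega) le_rfl).symm
      conn₂ := EQ_reachable h0₂ }
  · constructor
    · rintro (⟨e, -⟩ | ⟨-, h⟩ | ⟨e, -⟩)
      · exact Or.inl e
      · exact h.elim
      · exact Or.inr e
    · rintro (e | e)
      · exact Or.inl ⟨e, trivial⟩
      · exact Or.inr (Or.inr ⟨e, fun h => h.1 trivial⟩)
  · rcases Finset.mem_union.1 hF with h | h
    · obtain ⟨k, hk, rfl⟩ := Finset.mem_image.1 h
      have := (Finset.mem_filter.1 hk).2
      exact T.N₁_not_touching (by omega)
    · obtain ⟨k, hk, rfl⟩ := Finset.mem_image.1 h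
      exact T.N₂_not_touching (Finset.mem_filter.1 hk).2.2
  · rcases EN_faces (by omega) hb hF with ⟨k, hk, rfl⟩ | rfl | rfl
    · exact Or.inl (Finset.mem_image.2 ⟨k, Finset.mem_filter.2 ⟨Finset.mem_univ _, hk.le⟩, rfl⟩)
    · exact Or.inr rfl
    · exact Or.inl (Finset.mem_image.2 ⟨k₁, Finset.mem_filter.2 ⟨Finset.mem_univ _, le_rfl⟩, rfl⟩)
  · rcases EQ_faces (by omega) h0₂ hb hF with ⟨k, hk1, hk2, rfl⟩ | rfl
    · exact Or.inl (Finset.mem_image.2 ⟨k, Finset.mem_filter.2 ⟨Finset.mem_univ _, hk1, hk2⟩, rfl⟩)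
    · exact Or.inr rfl
  · rw [Finset.disjoint_left]
    intro F h1 h2
    obtain ⟨k, hk, rfl⟩ := Finset.mem_image.1 h1
    obtain ⟨k', -, e⟩ := Finset.mem_image.1 h2
    have hk' := (Finset.mem_filter.1 hk).2
    rcases (T.N₁_eq_N₂_imp e.symm).1 with h | h <;> omega
  · rw [Finset.disjoint_left]
    intro b hb1 hb2
    obtain ⟨k, hk, rfl⟩ := mem_EN_iff.1 hb1
    exact T.nbond₁_not_mem_EQ₂ (by omega) hb2

/-- ★ **THE `(P, c)` PENDANT CASE** from the marks data `(Ω; M̂ + P + c)`: `E₁ = P — ⋯ — a` rooted at `P`, `E₂ = c — J — ⋯ — b` (through the interior bond) rooted at `c`.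
[cite: KhristoforovSmirnov2021, §1.2 (arXiv v1 p. 2: «IP(ξ) is a union of disjoint paths»); BollobasRiordan2006, Ch. 7 §7.2.2 pp. 168–169] -/
theorem pendantCase_pc {E : TriMarkedDomain (nm + 1 + 1)} (M : TwoCellMarks D E ja jb j (leftFaceDir h₁ (r₁ + 5)) (leftFaceDir h₁ (r₁ + (m₁ + 1)))) :
    PendantCase D h₁ h₂ r₁ m₁ k₁ r₂ m₂ k₂ ja jb j E True True (pcSet h₁ h₂ r₁ m₁ k₁ r₂ k₂) (EN h₁ r₁ k₁) (insert (nbond h₁ (r₁ + (m₁ + 1))) (EN h₂ r₂ k₂))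
      (((Finset.univ : Finset (Fin 6)).filter fun k => k ≤ k₁).image fun k => leftFaceDir h₁ (r₁ + k))
      (insert (leftFaceDir h₁ (r₁ + m₁)) (((Finset.univ : Finset (Fin 6)).filter fun k => k ≤ k₂).image fun k => leftFaceDir h₂ (r₂ + k)))
      (leftFaceDir h₁ (r₁ + 5)) (leftFaceDir h₁ (r₁ + (m₁ + 1))) := by
  have hm₁ := T.m₁_le
  have hm₂ := T.m₂_le
  have h0₁ := T.k₁_lt
  have h0₂ := T.k₂_lt
  refine
    { marks := M
      R₁_touching := T.P_touching
      R₂_touching := T.c_touching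
      root_iff := fun F _ => ?_
      profile := T.twoCellProfile_pc
      N_eq := rfl
      S_outer := fun F hF => ?_
      faces₁ := fun b hb F hF => ?_
      faces₂ := fun b hb F hF => ?_
      disjS := ?_
      disj₁₂ := ?_
      a_mem := Finset.mem_image.2 ⟨k₁, Finset.mem_filter.2 ⟨Finset.mem_univ _, le_rfl⟩, rfl⟩
      b_mem := Finset.mem_insert_of_mem (Finset.mem_image.2 ⟨k₂, Finset.mem_filter.2 ⟨Finset.mem_univ _, le_rfl⟩, rfl⟩)
      conn₁ := (EN_reachable (by omega) le_rfl).symm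
      conn₂ := ?_ }
  · constructor
    · rintro (⟨e, -⟩ | ⟨e, -⟩ | ⟨-, h⟩)
      · exact Or.inl e
      · exact Or.inr e
      · exact absurd Iff.rfl h
    · rintro (e | e)
      · exact Or.inl ⟨e, trivial⟩
      · exact Or.inr (Or.inl ⟨e, trivial⟩)
  · rcases Finset.mem_union.1 hF with h | h
    · obtain ⟨k, hk, rfl⟩ := Finset.mem_image.1 h
      have := (Finset.mem_filter.1 hk).2
      exact T.N₁_not_touching (by omega)
    · rcases Finset.mem_insert.1 h with rfl | h
      · exact T.N₁_not_touching le_rfl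
      · obtain ⟨k, hk, rfl⟩ := Finset.mem_image.1 h
        have := (Finset.mem_filter.1 hk).2
        exact T.N₂_not_touching (by omega)
  · rcases EN_faces (by omega) hb hF with ⟨k, hk, rfl⟩ | rfl | rfl
    · exact Or.inl (Finset.mem_image.2 ⟨k, Finset.mem_filter.2 ⟨Finset.mem_univ _, hk.le⟩, rfl⟩)
    · exact Or.inr rfl
    · exact Or.inl (Finset.mem_image.2 ⟨k₁, Finset.mem_filter.2 ⟨Finset.mem_univ _, le_rfl⟩, rfl⟩)
  · rcases Finset.mem_insert.1 hb with rfl | hb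
    · rcases eq_N_or_of_inc (r₁ + (m₁ + 1)) hF with rfl | rfl
      · exact Or.inr rfl
      · rw [show r₁ + (m₁ + 1) + 5 = r₁ + m₁ by omega]
        exact Or.inl (Finset.mem_insert_self _ _)
    · rcases EN_faces (by omega) hb hF with ⟨k, hk, rfl⟩ | rfl | rfl
      · exact Or.inl (Finset.mem_insert_of_mem (Finset.mem_image.2 ⟨k, Finset.mem_filter.2 ⟨Finset.mem_univ _, hk.le⟩, rfl⟩))
      · rw [T.J_eq]; exact Or.inl (Finset.mem_insert_self _ _)
      · exact Or.inl (Finset.mem_insert_of_mem (Finset.mem_image.2 ⟨k₂, Finset.mem_filter.2 ⟨Finset.mem_univ _, le_rfl⟩, rfl⟩))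
  · rw [Finset.disjoint_left]
    intro F h1 h2
    obtain ⟨k, hk, rfl⟩ := Finset.mem_image.1 h1
    have hk' := (Finset.mem_filter.1 hk).2
    rcases Finset.mem_insert.1 h2 with e | h2
    · have := N_inj e; omega
    · obtain ⟨k', -, e⟩ := Finset.mem_image.1 h2
      rcases (T.N₁_eq_N₂_imp e.symm).1 with h | h <;> omega
  · rw [Finset.disjoint_left]
    intro b hb1 hb2
    obtain ⟨k, hk, rfl⟩ := mem_EN_iff.1 hb1
    rcases Finset.mem_insert.1 hb2 with e | hb2
    · exact T.nbond₁_ne_I (by omega) e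
    · exact T.nbond₁_not_mem_EN₂ (by omega) hb2
  · have h1 : (sideGraph (EN h₂ r₂ k₂)).Reachable (leftFaceDir h₂ (r₂ + 5)) (leftFaceDir h₂ (r₂ + k₂)) := EN_reachable (by omega) le_rfl
    rw [T.J_eq] at h1
    exact (h1.mono (ht2_sideGraph_mono (Finset.subset_insert _ _))).symm.trans (adj_J_c (Finset.mem_insert_self _ _)).reachable

/-- ★ **THE `(c, Q)` PENDANT CASE** from the marks data `(Ω; M̂ + c + Q)`: `E₁ = a — ⋯ — J — c` (through the interior bond) rooted at `c`, `E₂ = b — ⋯ — Q` rooted at `Q`.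
[cite: KhristoforovSmirnov2021, §1.2 (arXiv v1 p. 2: «IP(ξ) is a union of disjoint paths»); BollobasRiordan2006, Ch. 7 §7.2.2 pp. 168–169] -/
theorem pendantCase_cq {E : TriMarkedDomain (nm + 1 + 1)} (M : TwoCellMarks D E ja jb j (leftFaceDir h₁ (r₁ + (m₁ + 1))) (leftFaceDir h₂ (r₂ + m₂))) :
    PendantCase D h₁ h₂ r₁ m₁ k₁ r₂ m₂ k₂ ja jb j E False True (cqSet h₁ h₂ r₁ m₁ k₁ r₂ m₂ k₂) (insert (nbond h₁ (r₁ + (m₁ + 1))) (SlideData.EQ h₁ r₁ m₁ k₁))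
      (SlideData.EQ h₂ r₂ m₂ k₂)
      (((Finset.univ : Finset (Fin 6)).filter fun k => k₁ ≤ k ∧ k ≤ m₁).image fun k => leftFaceDir h₁ (r₁ + k))
      (((Finset.univ : Finset (Fin 6)).filter fun k => k₂ ≤ k ∧ k < m₂).image fun k => leftFaceDir h₂ (r₂ + k))
      (leftFaceDir h₁ (r₁ + (m₁ + 1))) (leftFaceDir h₂ (r₂ + m₂)) := by
  have hm₁ := T.m₁_le
  have hm₂ := T.m₂_le
  have h0₁ := T.k₁_lt
  have h0₂ := T.k₂_lt
  refine
    { marks := M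
      R₁_touching := T.c_touching
      R₂_touching := T.Q_touching
      root_iff := fun F _ => ?_
      profile := T.twoCellProfile_cq
      N_eq := rfl
      S_outer := fun F hF => ?_
      faces₁ := fun b hb F hF => ?_
      faces₂ := fun b hb F hF => ?_
      disjS := ?_
      disj₁₂ := ?_
      a_mem := Finset.mem_image.2 ⟨k₁, Finset.mem_filter.2 ⟨Finset.mem_univ _, le_rfl, h0₁.le⟩, rfl⟩
      b_mem := Finset.mem_image.2 ⟨k₂, Finset.mem_filter.2 ⟨Finset.mem_univ _, le_rfl, h0₂⟩, rfl⟩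
      conn₁ := ?_
      conn₂ := EQ_reachable h0₂ }
  · constructor
    · rintro (⟨-, h⟩ | ⟨e, -⟩ | ⟨e, -⟩)
      · exact h.elim
      · exact Or.inl e
      · exact Or.inr e
    · rintro (e | e)
      · exact Or.inr (Or.inl ⟨e, trivial⟩)
      · exact Or.inr (Or.inr ⟨e, fun h => h.2 trivial⟩)
  · rcases Finset.mem_union.1 hF with h | h
    · obtain ⟨k, hk, rfl⟩ := Finset.mem_image.1 h
      exact T.N₁_not_touching (Finset.mem_filter.1 hk).2.2
    · obtain ⟨k, hk, rfl⟩ := Finset.mem_image.1 h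
      exact T.N₂_not_touching (Finset.mem_filter.1 hk).2.2
  · rcases Finset.mem_insert.1 hb with rfl | hb
    · rcases eq_N_or_of_inc (r₁ + (m₁ + 1)) hF with rfl | rfl
      · exact Or.inr rfl
      · rw [show r₁ + (m₁ + 1) + 5 = r₁ + m₁ by omega]
        exact Or.inl (Finset.mem_image.2 ⟨m₁, Finset.mem_filter.2 ⟨Finset.mem_univ _, h0₁.le, le_rfl⟩, rfl⟩)
    · rcases EQ_faces (by omega) h0₁ hb hF with ⟨k, hk1, hk2, rfl⟩ | rfl
      · exact Or.inl (Finset.mem_image.2 ⟨k, Finset.mem_filter.2 ⟨Finset.mem_univ _, hk1, hk2.le⟩, rfl⟩)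
      · exact Or.inl (Finset.mem_image.2 ⟨m₁, Finset.mem_filter.2 ⟨Finset.mem_univ _, h0₁.le, le_rfl⟩, rfl⟩)
  · rcases EQ_faces (by omega) h0₂ hb hF with ⟨k, hk1, hk2, rfl⟩ | rfl
    · exact Or.inl (Finset.mem_image.2 ⟨k, Finset.mem_filter.2 ⟨Finset.mem_univ _, hk1, hk2⟩, rfl⟩)
    · exact Or.inr rfl
  · rw [Finset.disjoint_left]
    intro F h1 h2
    obtain ⟨k, hk, rfl⟩ := Finset.mem_image.1 h1
    obtain ⟨k', hk', e⟩ := Finset.mem_image.1 h2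
    have := (Finset.mem_filter.1 hk').2
    rcases (T.N₁_eq_N₂_imp e.symm).2 with h | h <;> omega
  · rw [Finset.disjoint_left]
    intro b hb1 hb2
    obtain ⟨k, hk, rfl⟩ := SlideData.mem_EQ_iff.1 hb2
    rcases Finset.mem_insert.1 hb1 with e | hb1
    · exact T.nbond₂_ne_I hk.2 e
    · exact T.nbond₂_not_mem_EQ₁ hk.2 hb1
  · exact ((EQ_reachable h0₁).mono (ht2_sideGraph_mono (Finset.subset_insert _ _))).trans (adj_J_c (Finset.mem_insert_self _ _)).reachable

/-- ★ **THE CAP CASE**: the path `a — ⋯ — J — ⋯ — b` along the outer boundary of the two cells, through outer faces only.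
[cite: KhristoforovSmirnov2021, §1.2 (arXiv v1 p. 2); PearceRittenbergDeGierNienhuis2002, §2 (the cap joins `j` to `j+1`); BollobasRiordan2006, Ch. 7 §7.2.2 pp. 168–169] -/
theorem capCase : CapCase D h₁ h₂ r₁ m₁ k₁ r₂ m₂ k₂ (capSet h₁ h₂ r₁ m₁ k₁ r₂ k₂)
    ((((Finset.univ : Finset (Fin 6)).filter fun k => k₁ ≤ k ∧ k ≤ m₁).image fun k => leftFaceDir h₁ (r₁ + k)) ∪
      (((Finset.univ : Finset (Fin 6)).filter fun k => k ≤ k₂).image fun k => leftFaceDir h₂ (r₂ + k))) := by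
  have hm₁ := T.m₁_le
  have hm₂ := T.m₂_le
  have h0₁ := T.k₁_lt
  have h0₂ := T.k₂_lt
  refine
    { profile := T.twoCellProfile_cap
      S_outer := fun F hF => ?_
      faces := fun b hb F hF => ?_
      a_mem := Finset.mem_union_left _ (Finset.mem_image.2 ⟨k₁, Finset.mem_filter.2 ⟨Finset.mem_univ _, le_rfl, h0₁.le⟩, rfl⟩)
      b_mem := Finset.mem_union_right _ (Finset.mem_image.2 ⟨k₂, Finset.mem_filter.2 ⟨Finset.mem_univ _, le_rfl⟩, rfl⟩)
      conn := ?_ }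
  · rcases Finset.mem_union.1 hF with h | h
    · obtain ⟨k, hk, rfl⟩ := Finset.mem_image.1 h
      exact T.N₁_not_touching (Finset.mem_filter.1 hk).2.2
    · obtain ⟨k, hk, rfl⟩ := Finset.mem_image.1 h
      have := (Finset.mem_filter.1 hk).2
      exact T.N₂_not_touching (by omega)
  · unfold capSet at hb
    rcases Finset.mem_union.1 hb with hb | hb
    · rcases EQ_faces (by omega) h0₁ hb hF with ⟨k, hk1, hk2, rfl⟩ | rfl
      · exact Finset.mem_union_left _ (Finset.mem_image.2 ⟨k, Finset.mem_filter.2 ⟨Finset.mem_univ _, hk1, hk2.le⟩, rfl⟩)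
      · exact Finset.mem_union_left _ (Finset.mem_image.2 ⟨m₁, Finset.mem_filter.2 ⟨Finset.mem_univ _, h0₁.le, le_rfl⟩, rfl⟩)
    · rcases EN_faces (by omega) hb hF with ⟨k, hk, rfl⟩ | rfl | rfl
      · exact Finset.mem_union_right _ (Finset.mem_image.2 ⟨k, Finset.mem_filter.2 ⟨Finset.mem_univ _, hk.le⟩, rfl⟩)
      · rw [T.J_eq]
        exact Finset.mem_union_left _ (Finset.mem_image.2 ⟨m₁, Finset.mem_filter.2 ⟨Finset.mem_univ _, h0₁.le, le_rfl⟩, rfl⟩)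
      · exact Finset.mem_union_right _ (Finset.mem_image.2 ⟨k₂, Finset.mem_filter.2 ⟨Finset.mem_univ _, le_rfl⟩, rfl⟩)
  · have h1 : (sideGraph (EN h₂ r₂ k₂)).Reachable (leftFaceDir h₂ (r₂ + 5)) (leftFaceDir h₂ (r₂ + k₂)) := EN_reachable (by omega) le_rfl
    rw [T.J_eq] at h1
    unfold capSet
    exact ((EQ_reachable h0₁).mono (ht2_sideGraph_mono Finset.subset_union_left)).trans (h1.mono (ht2_sideGraph_mono Finset.subset_union_right))

end TwoCellData

end Cases

/-! ## §2 The count identity and the law assembly -/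

section Law

variable {n : ℕ}

namespace TwoCellData

variable {W : TriMarkedDomain (n + 1 + 1 + 1)} {D : TriMarkedDomain (n + 1)} {h₁ h₂ : Site 2} {r₁ m₁ k₁ r₂ m₂ k₂ : Fin 6} {ja jb : Fin (n + 1 + 1 + 1)} {j : Fin (n + 1 + 1)}
  (T : TwoCellData W D h₁ h₂ r₁ m₁ k₁ r₂ m₂ k₂ ja jb j)
include T

open Classical in
/-- ★★★ **THE CAP-CASE CONFIGURATIONS ARE COUNTED BY THE CAP-INSERTION FIBRE**: at a boundary mid-edge `z` of the home arc of `D`, odd face `s`, the configurations of `W` avoiding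
`nb¹_0` and `I` with outermost pattern `p` are equinumerous — by deleting the cap path — with the configurations of `D` whose outermost pattern `q` has `q.capIns j = p` (one `q` or
none). [cite: KhristoforovSmirnov2021, §1.2 (arXiv v1 p. 2: the law of the link pattern), §2 Definition 3 (p. 4); PearceRittenbergDeGierNienhuis2002, §2 (monoid: the cup–cap)] -/
theorem card_filter_cap_eq_sum {N : Finset (Sym2 (Site 2))} {S : Finset HexVertex} (C : CapCase D h₁ h₂ r₁ m₁ k₁ r₂ m₂ k₂ N S) (z₀ : ArcPoint D (Fin.last n))
    {s : HexVertex} (hs₂ : s ∈ ({z₀.v, oppFace z₀.v z₀.i} : Finset HexVertex)) (hs : s ∈ triFacesTouching D.verts) (p : Pat₀ (n + 1 + 1 + 1)) :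
    #((TXb W z₀.v z₀.i s).filter fun ζ => (InClassX W (faceVertex z₀.v (z₀.i + 1)) (faceVertex z₀.v (z₀.i + 2)) s p.1.1.1 ζ ∧ linkRel W ζ = p.1.1.2) ∧
        (nbond h₁ r₁ ∉ ζ ∧ nbond h₁ (r₁ + (m₁ + 1)) ∉ ζ)) =
      ∑ q ∈ Finset.univ.filter (fun q : Pat₀ (n + 1) => q.capIns j = p),
        #((TXb D z₀.v z₀.i s).filter fun ξ => InClassX D (faceVertex z₀.v (z₀.i + 1)) (faceVertex z₀.v (z₀.i + 2)) s q.1.1.1 ξ ∧ linkRel D ξ = q.1.1.2) := by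
  have hz : side z₀.v z₀.i ∈ hBonds D := z₀.allSides z₀.i
  have hdisj : ∀ q ∈ Finset.univ.filter (fun q : Pat₀ (n + 1) => q.capIns j = p), ∀ q' ∈ Finset.univ.filter (fun q : Pat₀ (n + 1) => q.capIns j = p), q ≠ q' →
      Disjoint ((TXb D z₀.v z₀.i s).filter fun ξ => InClassX D (faceVertex z₀.v (z₀.i + 1)) (faceVertex z₀.v (z₀.i + 2)) s q.1.1.1 ξ ∧ linkRel D ξ = q.1.1.2)
        ((TXb D z₀.v z₀.i s).filter fun ξ => InClassX D (faceVertex z₀.v (z₀.i + 1)) (faceVertex z₀.v (z₀.i + 2)) s q'.1.1.1 ξ ∧ linkRel D ξ = q'.1.1.2) := by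
    intro q _ q' _ hne
    rw [Finset.disjoint_left]
    intro ξ h1 h2
    rw [Finset.mem_filter] at h1 h2
    exact hne (pat₀_unique_of_mem_TXb z₀.allSides hs₂ h1.1 h1.2 h2.2)
  rw [← Finset.card_biUnion hdisj]
  refine Finset.card_bij (fun ζ _ => ζ.filter (fun b => b ∈ hBonds D)) (fun ζ hζ => ?_) (fun ζ₁ h₁ ζ₂ h₂ e => ?_) (fun ξ hξ => ?_)
  · -- deleting the cap lands in a class of the fibre
    rw [Finset.mem_filter] at hζ
    obtain ⟨hmem, ⟨hcl, hL⟩, hx, hy⟩ := hζ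
    obtain ⟨e, hξD⟩ := T.eq_filter_union₀ C hs hmem hx hy
    rw [e] at hmem hcl hL
    have hξE : ζ.filter (fun b => b ∈ hBonds D) ∈ TXb D z₀.v z₀.i s := (T.union_mem_TXb_iff₀ C hξD hz hs).1 hmem
    obtain ⟨q, hq, hqL⟩ := exists_pat₀_of_mem_TXb z₀ hs₂ hξE
    have hpart : (q.capIns j).1.1.1 = p.1.1.1 := (T.inClassX_union_iff₀ C z₀.allSides hs₂ hs hξE q hq p.1.1.1).1 hcl
    have hrel : (q.capIns j).1.1.2 = p.1.1.2 := (T.linkRel_union_eq₀ C hξE q hqL).symm.trans hL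
    have hqp : q.capIns j = p := Subtype.ext (Subtype.ext (Prod.ext hpart hrel))
    exact Finset.mem_biUnion.2 ⟨q, Finset.mem_filter.2 ⟨Finset.mem_univ _, hqp⟩, Finset.mem_filter.2 ⟨hξE, hq, hqL⟩⟩
  · -- injective
    rw [Finset.mem_filter] at h₁ h₂
    rw [(T.eq_filter_union₀ C hs h₁.1 h₁.2.2.1 h₁.2.2.2).1, (T.eq_filter_union₀ C hs h₂.1 h₂.2.2.1 h₂.2.2.2).1, e]
  · -- surjective: add the cap
    obtain ⟨q, hq, hξq⟩ := Finset.mem_biUnion.1 hξ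
    rw [Finset.mem_filter] at hq hξq
    obtain ⟨hξE, hcl, hL⟩ := hξq
    have hqp : q.capIns j = p := hq.2
    have hξD : ξ ⊆ hBonds D := fun b hb => (Finset.mem_erase.1 (((mem_TXb_iff (D := D) z₀.v z₀.i s ξ).1 hξE).1 hb)).2
    refine ⟨ξ ∪ N, ?_, T.filter_union_eq₀ C hξD⟩
    rw [Finset.mem_filter]
    refine ⟨(T.union_mem_TXb_iff₀ C hξD hz hs).2 hξE, ⟨?_, ?_⟩, T.bits_union₀ C hξD⟩
    · exact (T.inClassX_union_iff₀ C z₀.allSides hs₂ hs hξE q hcl p.1.1.1).2 (by rw [hqp])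
    · rw [T.linkRel_union_eq₀ C hξE q hL, hqp]

open Classical in
/-- ★★★ **THE CLASS COUNT OF `W` SPLITS INTO THE FOUR CASES** (at one half of the edge): cap fibre + `(P, Q)` + `(P, c)` + `(c, Q)`.
[cite: KhristoforovSmirnov2021, §1.2 (arXiv v1 p. 2: the law of the link pattern), §2 Definition 3 (p. 4); PearceRittenbergDeGierNienhuis2002, §2 (monoid: the cup–cap)] -/
theorem card_filter_eq_four {EPQ EPc EcQ : TriMarkedDomain (n + 1 + 1 + 1)} {NPQ E₁PQ E₂PQ NPc E₁Pc E₂Pc NcQ E₁cQ E₂cQ N₀ : Finset (Sym2 (Site 2))}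
    {S₁PQ S₂PQ S₁Pc S₂Pc S₁cQ S₂cQ S₀ : Finset HexVertex} {RPQ₁ RPQ₂ RPc₁ RPc₂ RcQ₁ RcQ₂ : HexVertex}
    (CPQ : PendantCase D h₁ h₂ r₁ m₁ k₁ r₂ m₂ k₂ ja jb j EPQ True False NPQ E₁PQ E₂PQ S₁PQ S₂PQ RPQ₁ RPQ₂)
    (CPc : PendantCase D h₁ h₂ r₁ m₁ k₁ r₂ m₂ k₂ ja jb j EPc True True NPc E₁Pc E₂Pc S₁Pc S₂Pc RPc₁ RPc₂)
    (CcQ : PendantCase D h₁ h₂ r₁ m₁ k₁ r₂ m₂ k₂ ja jb j EcQ False True NcQ E₁cQ E₂cQ S₁cQ S₂cQ RcQ₁ RcQ₂)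
    (C₀ : CapCase D h₁ h₂ r₁ m₁ k₁ r₂ m₂ k₂ N₀ S₀) (z₀ : ArcPoint D (Fin.last n)) {s : HexVertex}
    (hs₂ : s ∈ ({z₀.v, oppFace z₀.v z₀.i} : Finset HexVertex)) (hs : s ∈ triFacesTouching D.verts) (q : Pat₀ (n + 1 + 1 + 1)) :
    #((TXb W z₀.v z₀.i s).filter fun ζ => InClassX W (faceVertex z₀.v (z₀.i + 1)) (faceVertex z₀.v (z₀.i + 2)) s q.1.1.1 ζ ∧ linkRel W ζ = q.1.1.2) =
      (∑ p ∈ Finset.univ.filter (fun p : Pat₀ (n + 1) => p.capIns j = q),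
          #((TXb D z₀.v z₀.i s).filter fun ξ => InClassX D (faceVertex z₀.v (z₀.i + 1)) (faceVertex z₀.v (z₀.i + 2)) s p.1.1.1 ξ ∧ linkRel D ξ = p.1.1.2)) +
        #((TXb EPQ z₀.v z₀.i s).filter fun ξ => InClassX EPQ (faceVertex z₀.v (z₀.i + 1)) (faceVertex z₀.v (z₀.i + 2)) s q.1.1.1 ξ ∧ linkRel EPQ ξ = q.1.1.2) +
        #((TXb EPc z₀.v z₀.i s).filter fun ξ => InClassX EPc (faceVertex z₀.v (z₀.i + 1)) (faceVertex z₀.v (z₀.i + 2)) s q.1.1.1 ξ ∧ linkRel EPc ξ = q.1.1.2) +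
        #((TXb EcQ z₀.v z₀.i s).filter fun ξ => InClassX EcQ (faceVertex z₀.v (z₀.i + 1)) (faceVertex z₀.v (z₀.i + 2)) s q.1.1.1 ξ ∧ linkRel EcQ ξ = q.1.1.2) := by
  have hz : side z₀.v z₀.i ∈ hBonds D := z₀.allSides z₀.i
  rw [← T.card_filter_cap_eq_sum C₀ z₀ hs₂ hs q, ← T.card_filter_case_eq CPQ hz hs q.1.1.1 q.1.1.2, ← T.card_filter_case_eq CPc hz hs q.1.1.1 q.1.1.2,
    ← T.card_filter_case_eq CcQ hz hs q.1.1.1 q.1.1.2]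
  -- split the class of `W` by the two bits
  set A := (TXb W z₀.v z₀.i s).filter fun ζ => InClassX W (faceVertex z₀.v (z₀.i + 1)) (faceVertex z₀.v (z₀.i + 2)) s q.1.1.1 ζ ∧ linkRel W ζ = q.1.1.2 with hA
  have key : ∀ F00 F10 F11 F01 : Finset (Finset (Sym2 (Site 2))),
      F00 = (A.filter fun ζ => ¬ nbond h₁ r₁ ∈ ζ).filter (fun ζ => ¬ nbond h₁ (r₁ + (m₁ + 1)) ∈ ζ) →
      F10 = (A.filter fun ζ => nbond h₁ r₁ ∈ ζ).filter (fun ζ => ¬ nbond h₁ (r₁ + (m₁ + 1)) ∈ ζ) →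
      F11 = (A.filter fun ζ => nbond h₁ r₁ ∈ ζ).filter (fun ζ => nbond h₁ (r₁ + (m₁ + 1)) ∈ ζ) →
      F01 = (A.filter fun ζ => ¬ nbond h₁ r₁ ∈ ζ).filter (fun ζ => nbond h₁ (r₁ + (m₁ + 1)) ∈ ζ) →
      #A = #F00 + #F10 + #F11 + #F01 := by
    intro F00 F10 F11 F01 e00 e10 e11 e01
    subst e00 e10 e11 e01
    have e1 := Finset.card_filter_add_card_filter_not (s := A) (fun ζ => nbond h₁ r₁ ∈ ζ)
    have e2 := Finset.card_filter_add_card_filter_not (s := A.filter fun ζ => nbond h₁ r₁ ∈ ζ) (fun ζ => nbond h₁ (r₁ + (m₁ + 1)) ∈ ζ)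
    have e3 := Finset.card_filter_add_card_filter_not (s := A.filter fun ζ => ¬ nbond h₁ r₁ ∈ ζ) (fun ζ => nbond h₁ (r₁ + (m₁ + 1)) ∈ ζ)
    beta_reduce at e1 e2 e3
    omega
  refine key _ _ _ _ ?_ ?_ ?_ ?_ <;>
    · rw [hA]
      ext ζ
      simp only [Finset.mem_filter, iff_true, iff_false, and_assoc]

/-- ★★★ **THE COUNT IDENTITY OF THE TWO-CELL CAP SURGERY**: at a boundary mid-edge `z` of the home arc of `D` and for every outermost pattern `q` of `k+2` corners,
`N^{W}_q(z) = Σ_{p : p.capIns j = q} N^{D}_p(z) + N^{E_PQ}_q(z) + N^{E_Pc}_q(z) + N^{E_cQ}_q(z)`.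
[cite: KhristoforovSmirnov2021, §1.2 (arXiv v1 p. 2: the law of the link pattern), §2 Definition 3 (p. 4); PearceRittenbergDeGierNienhuis2002, §2 (monoid: the cup–cap)] -/
theorem patternCount_eq {EPQ EPc EcQ : TriMarkedDomain (n + 1 + 1 + 1)} {NPQ E₁PQ E₂PQ NPc E₁Pc E₂Pc NcQ E₁cQ E₂cQ N₀ : Finset (Sym2 (Site 2))}
    {S₁PQ S₂PQ S₁Pc S₂Pc S₁cQ S₂cQ S₀ : Finset HexVertex} {RPQ₁ RPQ₂ RPc₁ RPc₂ RcQ₁ RcQ₂ : HexVertex}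
    (CPQ : PendantCase D h₁ h₂ r₁ m₁ k₁ r₂ m₂ k₂ ja jb j EPQ True False NPQ E₁PQ E₂PQ S₁PQ S₂PQ RPQ₁ RPQ₂)
    (CPc : PendantCase D h₁ h₂ r₁ m₁ k₁ r₂ m₂ k₂ ja jb j EPc True True NPc E₁Pc E₂Pc S₁Pc S₂Pc RPc₁ RPc₂)
    (CcQ : PendantCase D h₁ h₂ r₁ m₁ k₁ r₂ m₂ k₂ ja jb j EcQ False True NcQ E₁cQ E₂cQ S₁cQ S₂cQ RcQ₁ RcQ₂)
    (C₀ : CapCase D h₁ h₂ r₁ m₁ k₁ r₂ m₂ k₂ N₀ S₀) (z₀ : ArcPoint D (Fin.last n)) (q : Pat₀ (n + 1 + 1 + 1)) :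
    patternCount W z₀.v z₀.i q.1 = (∑ p ∈ Finset.univ.filter (fun p : Pat₀ (n + 1) => p.capIns j = q), patternCount D z₀.v z₀.i p.1) +
      patternCount EPQ z₀.v z₀.i q.1 + patternCount EPc z₀.v z₀.i q.1 + patternCount EcQ z₀.v z₀.i q.1 := by
  have hv : z₀.v ∈ triFacesTouching D.verts := mem_touching_of_side_mem D (z₀.allSides z₀.i)
  have ho : oppFace z₀.v z₀.i ∈ triFacesTouching D.verts :=
    mem_touching_of_side_mem D (j := oppIdx z₀.v z₀.i) (by rw [side_oppFace_oppIdx]; exact z₀.allSides z₀.i)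
  unfold patternCount
  rw [T.card_filter_eq_four CPQ CPc CcQ C₀ z₀ (by simp) hv q, T.card_filter_eq_four CPQ CPc CcQ C₀ z₀ (by simp) ho q, Finset.sum_add_distrib]
  ring

/-- ★★★★ **THE TWO-CELL CAP IDENTITY (from case data)**: `lawLP z_W = capInsL j (lawLP z_D) + lawLP z_PQ + lawLP z_Pc + lawLP z_cQ` for home-arc boundary mid-edges read at the same
face and side. [cite: KhristoforovSmirnov2021, §1.2 (arXiv v1 p. 2: the law of the link pattern); PearceRittenbergDeGierNienhuis2002, §2 (monoid; the link-pattern module)] -/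
theorem lawLP_eq_of_cases {EPQ EPc EcQ : TriMarkedDomain (n + 1 + 1 + 1)} {NPQ E₁PQ E₂PQ NPc E₁Pc E₂Pc NcQ E₁cQ E₂cQ N₀ : Finset (Sym2 (Site 2))}
    {S₁PQ S₂PQ S₁Pc S₂Pc S₁cQ S₂cQ S₀ : Finset HexVertex} {RPQ₁ RPQ₂ RPc₁ RPc₂ RcQ₁ RcQ₂ : HexVertex}
    (CPQ : PendantCase D h₁ h₂ r₁ m₁ k₁ r₂ m₂ k₂ ja jb j EPQ True False NPQ E₁PQ E₂PQ S₁PQ S₂PQ RPQ₁ RPQ₂)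
    (CPc : PendantCase D h₁ h₂ r₁ m₁ k₁ r₂ m₂ k₂ ja jb j EPc True True NPc E₁Pc E₂Pc S₁Pc S₂Pc RPc₁ RPc₂)
    (CcQ : PendantCase D h₁ h₂ r₁ m₁ k₁ r₂ m₂ k₂ ja jb j EcQ False True NcQ E₁cQ E₂cQ S₁cQ S₂cQ RcQ₁ RcQ₂)
    (C₀ : CapCase D h₁ h₂ r₁ m₁ k₁ r₂ m₂ k₂ N₀ S₀) (zW : ArcPoint W (Fin.last (n + 1 + 1))) (z₀ : ArcPoint D (Fin.last n))
    (zPQ : ArcPoint EPQ (Fin.last (n + 1 + 1))) (zPc : ArcPoint EPc (Fin.last (n + 1 + 1))) (zcQ : ArcPoint EcQ (Fin.last (n + 1 + 1)))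
    (hvW : zW.v = z₀.v) (hiW : zW.i = z₀.i) (hvPQ : zPQ.v = z₀.v) (hiPQ : zPQ.i = z₀.i) (hvPc : zPc.v = z₀.v) (hiPc : zPc.i = z₀.i)
    (hvcQ : zcQ.v = z₀.v) (hicQ : zcQ.i = z₀.i) :
    lawLP zW = capInsL ℂ (Fin.castSucc j) (lawLP z₀) + lawLP zPQ + lawLP zPc + lawLP zcQ :=
  lawLP_eq_capInsL_add₃ zW zPQ zPc zcQ z₀ j fun q => by
    rw [hvW, hiW, hvPQ, hiPQ, hvPc, hiPc, hvcQ, hicQ]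
    exact T.patternCount_eq CPQ CPc CcQ C₀ z₀ q

/-- ★★★★ **THE TWO-CELL CAP IDENTITY** `law(Ω∪h₁∪h₂; M̂+a+b) = cap_{a,b}·law(Ω; M̂) + law(Ω; M̂+P+Q) + law(Ω; M̂+P+c) + law(Ω; M̂+c+Q)`: for `W = (Ω ∪ h₁ ∪ h₂; M̂ + a + b)` over
`D = (Ω; M̂)` (`TwoCellData`) and the three small domains marked additionally at `(P, Q)`, `(P, c)`, `(c, Q)` at the indices of `a, b` (`TwoCellMarks`), the boundary link-pattern
laws at home-arc mid-edges read at the same face and side satisfy `lawLP z_W = capInsL j (lawLP z_D) + lawLP z_PQ + lawLP z_Pc + lawLP z_cQ` — the Bollobás–Riordan-representable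
replacement of the one-hexagon cap surgery F1 of the lane's BSPAN-by-towers programme.
[cite: KhristoforovSmirnov2021, §1.2 (arXiv v1 p. 2: the law of the link pattern), §2 Definition 3 (p. 4); PearceRittenbergDeGierNienhuis2002, §2 (monoid: `e_j` = cap ∘ contraction; the link-pattern module); BollobasRiordan2006, Ch. 7 §7.2.2 pp. 168–169] -/
theorem lawLP_eq_twoCellCap {EPQ EPc EcQ : TriMarkedDomain (n + 1 + 1 + 1)}
    (MPQ : TwoCellMarks D EPQ ja jb j (leftFaceDir h₁ (r₁ + 5)) (leftFaceDir h₂ (r₂ + m₂)))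
    (MPc : TwoCellMarks D EPc ja jb j (leftFaceDir h₁ (r₁ + 5)) (leftFaceDir h₁ (r₁ + (m₁ + 1))))
    (McQ : TwoCellMarks D EcQ ja jb j (leftFaceDir h₁ (r₁ + (m₁ + 1))) (leftFaceDir h₂ (r₂ + m₂)))
    (zW : ArcPoint W (Fin.last (n + 1 + 1))) (z₀ : ArcPoint D (Fin.last n))
    (zPQ : ArcPoint EPQ (Fin.last (n + 1 + 1))) (zPc : ArcPoint EPc (Fin.last (n + 1 + 1))) (zcQ : ArcPoint EcQ (Fin.last (n + 1 + 1)))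
    (hvW : zW.v = z₀.v) (hiW : zW.i = z₀.i) (hvPQ : zPQ.v = z₀.v) (hiPQ : zPQ.i = z₀.i) (hvPc : zPc.v = z₀.v) (hiPc : zPc.i = z₀.i)
    (hvcQ : zcQ.v = z₀.v) (hicQ : zcQ.i = z₀.i) :
    lawLP zW = capInsL ℂ (Fin.castSucc j) (lawLP z₀) + lawLP zPQ + lawLP zPc + lawLP zcQ :=
  T.lawLP_eq_of_cases (T.pendantCase_pq MPQ) (T.pendantCase_pc MPc) (T.pendantCase_cq McQ) T.capCase zW z₀ zPQ zPc zcQ hvW hiW hvPQ hiPQ hvPc hiPc hvcQ hicQ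

end TwoCellData

end Law

end Literature.Probability.Percolation.MarkedLoops
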